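import Mathlib
import Literature.NumberTheory.LFunctions.Zhang2022.Section16BVarpiLocal
import Literature.NumberTheory.LFunctions.Zhang2022.TypedSection16ALeaves
import Literature.NumberTheory.LFunctions.Zhang2022.Section15BcoefSupport
import HarnessLib

/-!
# Zhang (2022) §16 p. 93, u032–u033 (local reading): the EXACT re-indexing
# `Σ_{(n,𝔮)=1} b₁(n₁n)ϖ₂ⱼ^loc(n)/n = Σ_{n₁=l₁m₁} Σ_{(l,𝔮)=1} Σ_{(m,𝔮)=1} (l₁l)^{−β₃}g*(T²/(l₁l)) b(m₁m)χ(m₁m) ϖ₂ⱼ^loc(lm)/(lm)`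

Topic `Literature/NumberTheory/LFunctions/Zhang2022` (Landau–Siegel audit tree; verdict-neutral).
Y. Zhang, *Discrete mean estimates and the Landau–Siegel zero*, arXiv:2211.02515v1 (2022)
[Zhang2022LandauSiegel] — **an unrefereed manuscript under adjudication**; this file proves
bookkeeping identities about the campaign's typed §16 objects and asserts nothing about the
manuscript's theorems. ZHANG-L WP16 (seat zl-w16-p8), Block A of leaf h16_16 (binder `Eq16_16R2E`),
nodes `Z22:§16.u032`–`u033` [Z22 p. 93, tex L4605–L4614] in the local reading F16B-1: after
"for `(n,𝔮)=1` we have `b₁(n₁n) = Σ_{n₁=l₁m₁}Σ_{n=lm}(l₁l)^{−β₃}g*(T²/(l₁l))b(m₁m)`" (u032, tree: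
`Typed.Section16B.step16_u032_holds`), the sum over `(n,𝔮) = 1`, `n < P` of `b₁(n₁n)ϖ₂ⱼ^loc(n)/n` is
re-indexed by the pairs `(l,m)` of `𝔮`-rough numbers with `l < 2T²`, `m < P` — EXACTLY, with no error
term: the weight `g*(T²/(l₁l))` vanishes for `l₁l ≥ 2T²`, `b(m₁m)` vanishes for `m₁m ≥ P^{1/2}max(P₂,P₃)`
(the support of `b = u ⋆ v`, (15.2)), and `2T²·P^{1/2}max(P₂,P₃) ≤ P`
(`Typed.Section16ALeaves.suppBound_le_bigP`), so every surviving pair has `lm < P`.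

* `sum_rough_divisorsAntidiagonal_eq` — the generic re-indexing `Σ_{n rough <N} Σ_{n=lm} F(l,m) =
  Σ_{l rough <N_L} Σ_{m rough <N_M} F(l,m)` for `F` vanishing off the box and off `lm < N`;
* `bcoef_eq_zero_of_sqrtP_mul_max_le` — `b(n) = 0` for `n ≥ P^{1/2}max(P₂,P₃)`;
* `u033_reindex` — the exact triple-sum form of `Σ_{(n,𝔮)=1,n<P} b₁(n₁n)ϖ₂ⱼ^loc(n)/n` (given the u032
  identity at this `D` as a hypothesis, which `step16_u032_holds` supplies under the lane's binders);
* `u033_split` — algebra: the triple sum = `Σ_{n₁=l₁m₁}(Σ_l W ϖ^loc(l)/l)(Σ_m B ϖ^loc(m)/m)` + the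
  non-coprime correction `Σ W·B·(ϖ^loc(lm) − ϖ^loc(l)ϖ^loc(m))/(lm)` (which vanishes when `(l,m) = 1`
  by `varpi2loc_mul_of_coprime`).

## References
* Y. Zhang, arXiv:2211.02515v1 (2022), §16 p. 93 (u032, u033), tex L4605–L4614; §15 (15.2) p. 79.
  [cite: Zhang2022LandauSiegel, §16 p. 93 (u033)]
-/

noncomputable section

open Complex Real Finset Filter Topology

namespace Literature.NumberTheory.LFunctions.Zhang2022.Typed.Section16B

open Literature.NumberTheory.LFunctions.Zhang2022
open Literature.NumberTheory.LFunctions.Zhang2022.Skeleton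
open Literature.NumberTheory.LFunctions.Zhang2022.Typed.Section16A

/-! ## §1. Generic re-indexing of a rough double sum -/

/-- **Re-indexing a sum over `𝔮`-rough `n < N` and the divisor pairs of `n` by the pairs themselves**:
if `F(l,m)` vanishes whenever `l ≥ N_L`, whenever `m ≥ N_M`, and whenever `l, m ≥ 1` with `lm ≥ N`, then
`Σ_{1≤n<N,(n,K)=1} Σ_{(l,m): lm=n} F(l,m) = Σ_{1≤l<N_L,(l,K)=1} Σ_{1≤m<N_M,(m,K)=1} F(l,m)`
(both sides are the sum of `F` over all pairs of `K`-rough positive integers) — the combinatorial content of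
§16 p. 93 "Hence `Σ_{(n,𝔮)=1} b₁(n₁n)ϖ₂ⱼ(n)/n = Σ_{n₁=l₁m₁}Σ_{(l,𝔮)=1}…Σ_{(m,𝔮)=1}…`".
[cite: Zhang2022LandauSiegel, §16 p. 93 (u033)] -/
theorem sum_rough_divisorsAntidiagonal_eq {M : Type*} [AddCommMonoid M] {K N NL NM : ℕ}
    (F : ℕ × ℕ → M) (hL : ∀ y : ℕ × ℕ, NL ≤ y.1 → F y = 0) (hM : ∀ y : ℕ × ℕ, NM ≤ y.2 → F y = 0)
    (hN : ∀ y : ℕ × ℕ, 1 ≤ y.1 → 1 ≤ y.2 → N ≤ y.1 * y.2 → F y = 0) :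
    ∑ n ∈ (Finset.Ico 1 N).filter (fun n => Nat.Coprime n K), ∑ y ∈ n.divisorsAntidiagonal, F y =
      ∑ l ∈ (Finset.Ico 1 NL).filter (fun l => Nat.Coprime l K),
        ∑ m ∈ (Finset.Ico 1 NM).filter (fun m => Nat.Coprime m K), F (l, m) := by
  classical
  set RN := (Finset.Ico 1 N).filter (fun n => Nat.Coprime n K) with hRN
  set RL := (Finset.Ico 1 NL).filter (fun l => Nat.Coprime l K) with hRL
  set RM := (Finset.Ico 1 NM).filter (fun m => Nat.Coprime m K) with hRM
  -- the left side as a sum over the (disjoint) union of the divisor-pair sets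
  have hdisj : (RN : Set ℕ).PairwiseDisjoint Nat.divisorsAntidiagonal := by
    intro a _ b _ hab
    rw [Function.onFun, Finset.disjoint_left]
    intro y hya hyb
    exact hab ((Nat.mem_divisorsAntidiagonal.mp hya).1.symm.trans (Nat.mem_divisorsAntidiagonal.mp hyb).1)
  rw [← Finset.sum_biUnion hdisj, ← Finset.sum_product (s := RL) (t := RM) (f := F)]
  set T := RN.biUnion Nat.divisorsAntidiagonal with hT
  -- both are the sum over `T ∪ RL ×ˢ RM`
  have h1 : ∑ y ∈ T, F y = ∑ y ∈ T ∪ RL ×ˢ RM, F y := by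
    refine Finset.sum_subset Finset.subset_union_left fun y hy hyT => ?_
    rw [Finset.mem_union] at hy
    rcases hy with hy | hy
    · exact absurd hy hyT
    rw [Finset.mem_product, hRL, hRM, Finset.mem_filter, Finset.mem_filter, Finset.mem_Ico,
      Finset.mem_Ico] at hy
    obtain ⟨⟨⟨hl1, -⟩, hlK⟩, ⟨⟨hm1, -⟩, hmK⟩⟩ := hy
    refine hN y hl1 hm1 ?_
    by_contra hlt
    push Not at hlt
    apply hyT
    rw [hT, Finset.mem_biUnion]
    refine ⟨y.1 * y.2, ?_, ?_⟩
    · rw [hRN, Finset.mem_filter, Finset.mem_Ico]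
      exact ⟨⟨Nat.one_le_iff_ne_zero.mpr (Nat.mul_ne_zero (by omega) (by omega)), hlt⟩,
        Nat.Coprime.mul_left hlK hmK⟩
    · rw [Nat.mem_divisorsAntidiagonal]
      exact ⟨rfl, Nat.mul_ne_zero (by omega) (by omega)⟩
  have h2 : ∑ y ∈ RL ×ˢ RM, F y = ∑ y ∈ T ∪ RL ×ˢ RM, F y := by
    refine Finset.sum_subset Finset.subset_union_right fun y hy hyP => ?_
    rw [Finset.mem_union] at hy
    rcases hy with hy | hy
    swap
    · exact absurd hy hyP
    rw [hT, Finset.mem_biUnion] at hy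
    obtain ⟨n, hn, hyn⟩ := hy
    rw [hRN, Finset.mem_filter, Finset.mem_Ico] at hn
    obtain ⟨⟨hn1, -⟩, hnK⟩ := hn
    obtain ⟨hprod, hn0⟩ := Nat.mem_divisorsAntidiagonal.mp hyn
    have hy1 : 1 ≤ y.1 := Nat.one_le_iff_ne_zero.mpr fun h => hn0 (by rw [← hprod, h, zero_mul])
    have hy2 : 1 ≤ y.2 := Nat.one_le_iff_ne_zero.mpr fun h => hn0 (by rw [← hprod, h, mul_zero])
    have hc1 : Nat.Coprime y.1 K := Nat.Coprime.coprime_dvd_left (Dvd.intro _ hprod) hnK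
    have hc2 : Nat.Coprime y.2 K := Nat.Coprime.coprime_dvd_left (Dvd.intro_left _ hprod) hnK
    -- `y ∉ RL ×ˢ RM` ⇒ `y.1 ≥ NL` or `y.2 ≥ NM`
    rw [Finset.mem_product, not_and_or] at hyP
    rcases hyP with h | h
    · refine hL y ?_
      by_contra hlt; push Not at hlt
      exact h (by rw [hRL, Finset.mem_filter, Finset.mem_Ico]; exact ⟨⟨hy1, hlt⟩, hc1⟩)
    · refine hM y ?_
      by_contra hlt; push Not at hlt
      exact h (by rw [hRM, Finset.mem_filter, Finset.mem_Ico]; exact ⟨⟨hy2, hlt⟩, hc2⟩)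
  rw [h1, h2]

/-! ## §2. The support of `b` at the threshold `P^{1/2}·max(P₂,P₃)` -/

section Support

variable {D : ℕ}

/-- `ϰ₂(n) = 0` for `n ≥ P₂`. [cite: Zhang2022LandauSiegel, §8 (8.6)] -/
private theorem vk2_eq_zero_of_P2_le' {n : ℕ} (h : Skeleton.P2 D ≤ n) : vk2 D n = 0 := by
  rw [vk2, if_neg (not_lt.mpr h)]

/-- `ϰ₃(n) = 0` for `n ≥ P₃`. [cite: Zhang2022LandauSiegel, §8 (8.6)] -/
private theorem vk3_eq_zero_of_P3_le' {n : ℕ} (h : P3 D ≤ n) : vk3 D n = 0 := by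
  rw [vk3, if_neg (not_lt.mpr h)]

/-- `P₂ ≤ P^{1/2}` (`P₂ = P^{1/2}T⁻¹⁰`). [cite: Zhang2022LandauSiegel, §2 (2.21)] -/
private theorem P2_le_sqrtP'' : Skeleton.P2 D ≤ bigP D ^ (1 / 2 : ℝ) := by
  have hT : 1 ≤ bigT D ^ 10 :=
    one_le_pow₀ (Real.one_le_exp (Real.rpow_nonneg (Real.log_natCast_nonneg D) _))
  have h0 : 0 ≤ bigP D ^ (1 / 2 : ℝ) := Real.rpow_nonneg (Real.exp_pos _).le _
  rw [Skeleton.P2, show (0.5 : ℝ) = 1 / 2 by norm_num]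
  exact div_le_self h0 hT

/-- **`b(n) = 0` for `n ≥ P^{1/2}·max(P₂,P₃)`** (the support of `b = u ⋆ v`: `u` lives on `n < P^{1/2}`,
`v` on `n < max(P₂,P₃)`; sharper than the printed (15.2) threshold).
[cite: Zhang2022LandauSiegel, §15 (15.2) p. 79] -/
theorem bcoef_eq_zero_of_sqrtP_mul_max_le {n : ℕ}
    (hn : bigP D ^ (1 / 2 : ℝ) * max (Skeleton.P2 D) (P3 D) ≤ n) : bcoef D n = 0 := by
  rw [bcoef]
  refine Finset.sum_eq_zero fun q hq => ?_
  by_contra hne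
  have hu := left_ne_zero_of_mul hne
  have hv := right_ne_zero_of_mul hne
  have ha : (q.1 : ℝ) < bigP D ^ (1 / 2 : ℝ) := by
    by_contra h
    rw [not_lt] at h
    apply hu
    rw [if_neg (not_lt.mpr h), vk2_eq_zero_of_P2_le' (le_trans P2_le_sqrtP'' h)]
    simp
  have hb : (q.2 : ℝ) < max (Skeleton.P2 D) (P3 D) := by
    by_contra h
    rw [not_lt] at h
    apply hv
    rw [vk3_eq_zero_of_P3_le' (le_trans (le_max_right _ _) h),
      vk2_eq_zero_of_P2_le' (le_trans (le_max_left _ _) h)]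
    simp
  have hqn : (q.1 : ℝ) * q.2 = n := by
    have := (Nat.mem_divisorsAntidiagonal.mp hq).1
    exact_mod_cast this
  have hlt : (n : ℝ) < bigP D ^ (1 / 2 : ℝ) * max (Skeleton.P2 D) (P3 D) := by
    rw [← hqn]
    exact mul_lt_mul'' ha hb (Nat.cast_nonneg _) (Nat.cast_nonneg _)
  linarith

/-- `g*(y) = 0` for `y ≤ 1/2`. [cite: Zhang2022LandauSiegel, §6 p. 30 (`g*`)] -/
theorem gstar_eq_zero_of_le_half {y : ℝ} (hy : y ≤ 1 / 2) : gstar D y = 0 := by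
  rw [gstar, if_neg (not_lt.mpr hy)]

end Support

/-! ## §3. The exact triple-sum form (u032 ⇒ u033 without the error term) -/

section Reindex

variable (c' : ℝ) {D : ℕ} (χ : DirichletCharacter ℂ D)

open scoped Classical in
/-- **u033, exact re-indexing** (local reading): for `𝓛 ≥ 10`, `n₁ ≠ 0`, `j`, given the u032 identity
for `b₁(n₁n)` at the rough `n` (tree: `step16_u032_holds`),
`Σ_{1≤n<⌈P⌉,(n,𝔮)=1} b₁(n₁n)ϖ₂ⱼ^loc(n)/n = Σ_{x=(l₁,m₁), l₁m₁=n₁} Σ_{1≤l<⌈2T²⌉,(l,𝔮)=1} Σ_{1≤m<⌈P⌉,(m,𝔮)=1}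
(l₁l)^{−β₃}g*(T²/(l₁l))·b(m₁m)χ(m₁m)·ϖ₂ⱼ^loc(lm)/(lm)` — exactly: off the box the weight or `b`
vanishes, and on the support `lm ≤ (l₁l)(m₁m) < 2T²·P^{1/2}max(P₂,P₃) ≤ P`.
[cite: Zhang2022LandauSiegel, §16 p. 93 (u032–u033)] -/
theorem u033_reindex (hℓ : 10 ≤ ell D) (j : ℕ) {n₁ : ℕ} (hn₁ : n₁ ≠ 0)
    (h32 : ∀ n : ℕ, 1 ≤ n → Nat.Coprime n (frakq D) →
      b1coef c' χ (n₁ * n) =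
        ∑ x ∈ n₁.divisorsAntidiagonal, ∑ y ∈ n.divisorsAntidiagonal,
          (((x.1 * y.1 : ℕ) : ℂ)) ^ (-beta3 c' D) * (gstar D (bigT D ^ 2 / ((x.1 * y.1 : ℕ) : ℝ)) : ℂ) *
            (bcoef D (x.2 * y.2) * χ ((x.2 * y.2 : ℕ) : ZMod D))) :
    ∑ n ∈ (Finset.Ico 1 ⌈bigP D⌉₊).filter (fun n => Nat.Coprime n (frakq D)),
        b1coef c' χ (n₁ * n) * varpi2loc c' χ j n / (n : ℂ) =
      ∑ x ∈ n₁.divisorsAntidiagonal,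
        ∑ l ∈ (Finset.Ico 1 ⌈2 * bigT D ^ 2⌉₊).filter (fun l => Nat.Coprime l (frakq D)),
          ∑ m ∈ (Finset.Ico 1 ⌈bigP D⌉₊).filter (fun m => Nat.Coprime m (frakq D)),
            (((x.1 * l : ℕ) : ℂ)) ^ (-beta3 c' D) * (gstar D (bigT D ^ 2 / ((x.1 * l : ℕ) : ℝ)) : ℂ) *
              (bcoef D (x.2 * m) * χ ((x.2 * m : ℕ) : ZMod D)) *
              (varpi2loc c' χ j (l * m) / (((l * m : ℕ) : ℂ))) := by
  set K := frakq D with hK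
  set RN := (Finset.Ico 1 ⌈bigP D⌉₊).filter (fun n => Nat.Coprime n K) with hRN
  -- the weight-times-coefficient kernel for a fixed outer pair `x`
  set G : ℕ × ℕ → ℕ × ℕ → ℂ := fun x y =>
    (((x.1 * y.1 : ℕ) : ℂ)) ^ (-beta3 c' D) * (gstar D (bigT D ^ 2 / ((x.1 * y.1 : ℕ) : ℝ)) : ℂ) *
      (bcoef D (x.2 * y.2) * χ ((x.2 * y.2 : ℕ) : ZMod D)) with hG
  -- Step 1: insert u032 and move `ϖ^loc(n)/n` inside as `ϖ^loc(y.1 y.2)/(y.1 y.2)`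
  have step1 : ∑ n ∈ RN, b1coef c' χ (n₁ * n) * varpi2loc c' χ j n / (n : ℂ) =
      ∑ x ∈ n₁.divisorsAntidiagonal, ∑ n ∈ RN, ∑ y ∈ n.divisorsAntidiagonal,
        G x y * (varpi2loc c' χ j (y.1 * y.2) / (((y.1 * y.2 : ℕ) : ℂ))) := by
    rw [Finset.sum_comm]
    refine Finset.sum_congr rfl fun n hn => ?_
    rw [hRN, Finset.mem_filter, Finset.mem_Ico] at hn
    rw [h32 n hn.1.1 hn.2, Finset.sum_mul, Finset.sum_div]
    refine Finset.sum_congr rfl fun x _ => ?_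
    rw [Finset.sum_mul, Finset.sum_div]
    refine Finset.sum_congr rfl fun y hy => ?_
    rw [(Nat.mem_divisorsAntidiagonal.mp hy).1, hG]
    ring
  rw [step1]
  refine Finset.sum_congr rfl fun x hx => ?_
  -- sizes
  have hx0 := Nat.mem_divisorsAntidiagonal.mp hx
  have hx1 : 1 ≤ x.1 := Nat.one_le_iff_ne_zero.mpr fun h => hn₁ (by rw [← hx0.1, h, zero_mul])
  have hx2 : 1 ≤ x.2 := Nat.one_le_iff_ne_zero.mpr fun h => hn₁ (by rw [← hx0.1, h, mul_zero])
  have hT0 : 0 < bigT D := Real.exp_pos _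
  have hT2 : 0 < bigT D ^ 2 := pow_pos hT0 2
  have hsupp := Typed.Section16ALeaves.suppBound_le_bigP (D := D) hℓ
  have hceilP : bigP D ≤ ((⌈bigP D⌉₊ : ℕ) : ℝ) := Nat.le_ceil _
  have hceilT : 2 * bigT D ^ 2 ≤ ((⌈2 * bigT D ^ 2⌉₊ : ℕ) : ℝ) := Nat.le_ceil _
  -- the two vanishing mechanisms
  have hgz : ∀ l : ℕ, 2 * bigT D ^ 2 ≤ ((x.1 * l : ℕ) : ℝ) →
      gstar D (bigT D ^ 2 / ((x.1 * l : ℕ) : ℝ)) = 0 := by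
    intro l hl
    apply gstar_eq_zero_of_le_half
    have hpos : (0 : ℝ) < ((x.1 * l : ℕ) : ℝ) := lt_of_lt_of_le (by positivity) hl
    rw [div_le_iff₀ hpos]
    linarith
  have hbz : ∀ m : ℕ, bigP D ^ (1 / 2 : ℝ) * max (Skeleton.P2 D) (P3 D) ≤ ((x.2 * m : ℕ) : ℝ) →
      bcoef D (x.2 * m) = 0 := fun m hm => bcoef_eq_zero_of_sqrtP_mul_max_le hm
  refine sum_rough_divisorsAntidiagonal_eq
    (F := fun y => G x y * (varpi2loc c' χ j (y.1 * y.2) / (((y.1 * y.2 : ℕ) : ℂ)))) ?_ ?_ ?_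
  · -- `l ≥ ⌈2T²⌉` ⇒ the weight vanishes
    intro y hy
    have hl : 2 * bigT D ^ 2 ≤ ((x.1 * y.1 : ℕ) : ℝ) := by
      calc 2 * bigT D ^ 2 ≤ ((⌈2 * bigT D ^ 2⌉₊ : ℕ) : ℝ) := hceilT
        _ ≤ (y.1 : ℝ) := by exact_mod_cast hy
        _ ≤ ((x.1 * y.1 : ℕ) : ℝ) := by
            push_cast; exact le_mul_of_one_le_left (Nat.cast_nonneg _) (by exact_mod_cast hx1)
    simp only [hG, hgz y.1 hl, Complex.ofReal_zero, mul_zero, zero_mul]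
  · -- `m ≥ ⌈P⌉` ⇒ `b(m₁m)` vanishes
    intro y hy
    have hm : bigP D ^ (1 / 2 : ℝ) * max (Skeleton.P2 D) (P3 D) ≤ ((x.2 * y.2 : ℕ) : ℝ) := by
      have h2T : 1 ≤ 2 * bigT D ^ 2 := by
        have : 1 ≤ bigT D := Real.one_le_exp (by positivity)
        nlinarith
      have hMb0 : 0 ≤ bigP D ^ (1 / 2 : ℝ) * max (Skeleton.P2 D) (P3 D) := by
        have h1 : 0 ≤ bigP D ^ (1 / 2 : ℝ) := Real.rpow_nonneg (Real.exp_pos _).le _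
        have h2 : 0 ≤ max (Skeleton.P2 D) (P3 D) :=
          le_trans (Real.rpow_nonneg (Real.exp_pos _).le _) (le_max_right _ _)
        exact mul_nonneg h1 h2
      calc bigP D ^ (1 / 2 : ℝ) * max (Skeleton.P2 D) (P3 D)
          ≤ 2 * bigT D ^ 2 * (bigP D ^ (1 / 2 : ℝ) * max (Skeleton.P2 D) (P3 D)) :=
            le_mul_of_one_le_left hMb0 h2T
        _ ≤ bigP D := hsupp
        _ ≤ ((⌈bigP D⌉₊ : ℕ) : ℝ) := hceilP
        _ ≤ (y.2 : ℝ) := by exact_mod_cast hy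
        _ ≤ ((x.2 * y.2 : ℕ) : ℝ) := by
            push_cast; exact le_mul_of_one_le_left (Nat.cast_nonneg _) (by exact_mod_cast hx2)
    simp only [hG, hbz y.2 hm, zero_mul, mul_zero]
  · -- `lm ≥ ⌈P⌉` with `l, m ≥ 1` ⇒ one of the two vanishes
    intro y hy1 hy2 hN
    by_cases hl : 2 * bigT D ^ 2 ≤ ((x.1 * y.1 : ℕ) : ℝ)
    · simp only [hG, hgz y.1 hl, Complex.ofReal_zero, mul_zero, zero_mul]
    by_cases hm : bigP D ^ (1 / 2 : ℝ) * max (Skeleton.P2 D) (P3 D) ≤ ((x.2 * y.2 : ℕ) : ℝ)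
    · simp only [hG, hbz y.2 hm, zero_mul, mul_zero]
    exfalso
    push Not at hl hm
    have h0 : (0 : ℝ) ≤ ((x.1 * y.1 : ℕ) : ℝ) := Nat.cast_nonneg _
    have hprod : ((x.1 * y.1 : ℕ) : ℝ) * ((x.2 * y.2 : ℕ) : ℝ) <
        2 * bigT D ^ 2 * (bigP D ^ (1 / 2 : ℝ) * max (Skeleton.P2 D) (P3 D)) :=
      mul_lt_mul'' hl hm h0 (Nat.cast_nonneg _)
    have hge : ((⌈bigP D⌉₊ : ℕ) : ℝ) ≤ ((x.1 * y.1 : ℕ) : ℝ) * ((x.2 * y.2 : ℕ) : ℝ) := by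
      have h1 : ((y.1 * y.2 : ℕ) : ℝ) ≤ ((x.1 * y.1 : ℕ) : ℝ) * ((x.2 * y.2 : ℕ) : ℝ) := by
        have : y.1 * y.2 ≤ (x.1 * y.1) * (x.2 * y.2) := by
          calc y.1 * y.2 = (1 * y.1) * (1 * y.2) := by ring
            _ ≤ (x.1 * y.1) * (x.2 * y.2) :=
                Nat.mul_le_mul (Nat.mul_le_mul_right _ hx1) (Nat.mul_le_mul_right _ hx2)
        exact_mod_cast this
      exact le_trans (by exact_mod_cast hN) h1
    linarith

/-- **u033, algebraic split** of the triple sum: with `W(l) = (l₁l)^{−β₃}g*(T²/(l₁l))`,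
`B(m) = b(m₁m)χ(m₁m)`,
`Σ_l Σ_m W(l)B(m)ϖ^loc(lm)/(lm) = (Σ_l W(l)ϖ^loc(l)/l)(Σ_m B(m)ϖ^loc(m)/m) + Σ_l Σ_m W(l)B(m)(ϖ^loc(lm) − ϖ^loc(l)ϖ^loc(m))/(lm)`
over any finite ranges of positive integers. [cite: Zhang2022LandauSiegel, §16 p. 93 (u033)] -/
theorem u033_split (j : ℕ) (W B : ℕ → ℂ) (RL RM : Finset ℕ) (hL : ∀ l ∈ RL, l ≠ 0)
    (hM : ∀ m ∈ RM, m ≠ 0) :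
    ∑ l ∈ RL, ∑ m ∈ RM, W l * B m * (varpi2loc c' χ j (l * m) / (((l * m : ℕ) : ℂ))) =
      (∑ l ∈ RL, W l * varpi2loc c' χ j l / (l : ℂ)) * (∑ m ∈ RM, B m * varpi2loc c' χ j m / (m : ℂ)) +
        ∑ l ∈ RL, ∑ m ∈ RM, W l * B m *
          ((varpi2loc c' χ j (l * m) - varpi2loc c' χ j l * varpi2loc c' χ j m) / (((l * m : ℕ) : ℂ))) := by
  rw [Finset.sum_mul_sum, ← Finset.sum_add_distrib]
  refine Finset.sum_congr rfl fun l hl => ?_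
  rw [← Finset.sum_add_distrib]
  refine Finset.sum_congr rfl fun m hm => ?_
  have hl0 : (l : ℂ) ≠ 0 := by exact_mod_cast hL l hl
  have hm0 : (m : ℂ) ≠ 0 := by exact_mod_cast hM m hm
  push_cast
  field_simp
  ring

/-- The non-coprime correction vanishes on coprime pairs: `ϖ^loc(lm) = ϖ^loc(l)ϖ^loc(m)` for
`(l,m) = 1` (`varpi2loc_mul_of_coprime`). [cite: Zhang2022LandauSiegel, §16 p. 93 (u033)] -/
theorem varpi2loc_mul_sub_eq_zero_of_coprime [NeZero D] (j : ℕ) {l m : ℕ} (h : Nat.Coprime l m) :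
    varpi2loc c' χ j (l * m) - varpi2loc c' χ j l * varpi2loc c' χ j m = 0 := by
  rw [varpi2loc_mul_of_coprime c' χ j h, sub_self]

end Reindex

end Literature.NumberTheory.LFunctions.Zhang2022.Typed.Section16B
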